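import Summits.NavierStokesRegularity.NavierStokesRegularity.Theorems.SymmetricLiouville.Negative.RssFarFieldLoadBearing
import Literature.Analysis.PDE.NewtonianKernel
import HarnessLib

/-!
# The decaying swirl `Jx/(‖x‖² − t)`: envelope, singular apex, trace slice, unit-scale energy,
# backward self-similarity

Refuter-side negative-lane lemmas (seat ns-afl-r1 g7, `--supports stmt-NavierStokesRegularity-24077`),
used by `Negative/ThinObjectGaugeLoadBearing.lean` (stub S3 `stub_thinCascadeLiouville` of line
`thin_cascade`: the Oseen/KNSS gauge is load-bearing).  Nothing about Navier–Stokes is proved here and no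
summit statement is.  The object is the tree's witness of the `SymmetricLiouville` negative lane,
`swirlField t x = Jx/(‖x‖² − t)` and `swirlScaled κ = κ • swirlField` (`RssFarFieldLoadBearing`:
jointly smooth on `t < 0`, divergence free, Type-I with constant `κ`); added here:

* `norm_swirlField_le_inv` — the envelope `‖swirlField t x‖ ≤ 1/‖x‖` for `t ≤ 0`, `x ≠ 0`;
* `norm_swirlField_axis` — the singular apex: `‖swirlField (−ρ²) (ρ f₀)‖ = 1/(2ρ)`;
* `tendsto_swirlField_zero`, `measurable_swirlField_zero` — the slices converge pointwise off the
  origin to the (measurable) trace slice `swirlField 0 = Jx/‖x‖²` as `t → 0⁻`;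
* `lintegral_ball_sq_swirlField_le`, `lintegral_ball_rpow_neg_two_lt_top` — uniform unit-scale energy
  `∫_{B(x₀,1)} ‖swirlField t‖² ≤ ∫_{B₁}‖y‖⁻² + |B₁| < ∞` for all centres `x₀` and all `t ≤ 0`;
* `isSelfSimilar_swirlScaled` — `λ v(λ²t, λx) = v(t,x)`: the scaled swirl is backward self-similar.

Standard axioms only.
-/

noncomputable section

-- the summit and its single sub-problem share the name (CONVENTIONS §1), as in every Theorems file
set_option linter.dupNamespace false

namespace Summit.NavierStokesRegularity.NavierStokesRegularity.Theorems.TypeIQuantSubcubicExp.Negative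

open MeasureTheory Set Filter Topology Metric Function
open Literature.Analysis Literature.Analysis.FluidPDE
open Summit.NavierStokesRegularity.NavierStokesRegularity.Theorems.SymmetricLiouville.Negative
open scoped ENNReal NNReal RealInnerProductSpace

/-! ### More on the swirl `Jx/(‖x‖² − t)`: envelope, apex, trace, energy, self-similarity -/

/-- **The spatial envelope** `‖Jx/(‖x‖² − t)‖ ≤ 1/‖x‖` for `t ≤ 0`, `x ≠ 0` (so also for the trace
slice `t = 0`). -/
theorem norm_swirlField_le_inv {t : ℝ} (ht : t ≤ 0) {x : EuclideanSpace ℝ (Fin 3)} (hx : x ≠ 0) :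
    ‖swirlField t x‖ ≤ 1 / ‖x‖ := by
  have hxpos : 0 < ‖x‖ := norm_pos_iff.2 hx
  have hx2 : 0 < ‖x‖ ^ 2 := by positivity
  have hden : 0 < ‖x‖ ^ 2 - t := by linarith
  rw [swirlField_apply, norm_smul, Real.norm_eq_abs, abs_of_pos (inv_pos.2 hden)]
  calc (‖x‖ ^ 2 - t)⁻¹ * ‖rotJ x‖ ≤ (‖x‖ ^ 2)⁻¹ * ‖x‖ :=
      mul_le_mul (by rw [inv_le_inv₀ hden hx2]; linarith) (norm_rotJ_le x) (norm_nonneg _)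
        (inv_pos.2 hx2).le
    _ = 1 / ‖x‖ := by rw [pow_two, mul_inv, mul_assoc, inv_mul_cancel₀ hxpos.ne', mul_one, one_div]

/-- **Singular apex**: on the parabola `t = −ρ²`, at distance `ρ` on the `f₀`-axis,
`‖swirlField (−ρ²) (ρ f₀)‖ = 1/(2ρ)`. -/
theorem norm_swirlField_axis {ρ : ℝ} (hρ : 0 < ρ) : ‖swirlField (-(ρ ^ 2)) (ρ • f0)‖ = (2 * ρ)⁻¹ := by
  have hn : ‖ρ • f0‖ = ρ := by rw [norm_smul, norm_f0, mul_one, Real.norm_eq_abs, abs_of_pos hρ]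
  have h2 : (0 : ℝ) < ρ ^ 2 + ρ ^ 2 := by positivity
  rw [swirlField_apply, map_smul, rotJ_f0, hn, sub_neg_eq_add, norm_smul, norm_smul, norm_e1, mul_one,
    Real.norm_eq_abs, Real.norm_eq_abs, abs_of_pos hρ, abs_of_pos (inv_pos.2 h2)]
  field_simp
  ring

/-- **Pointwise convergence to the trace slice** off the apex: `swirlField t x → swirlField 0 x` as
`t → 0⁻`, for `x ≠ 0`. -/
theorem tendsto_swirlField_zero {x : EuclideanSpace ℝ (Fin 3)} (hx : x ≠ 0) :
    Tendsto (fun t : ℝ => swirlField t x) (𝓝[<] 0) (𝓝 (swirlField 0 x)) := by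
  have hx2 : (‖x‖ ^ 2 - 0 : ℝ) ≠ 0 := by rw [sub_zero]; positivity
  have h : Tendsto (fun t : ℝ => ‖x‖ ^ 2 - t) (𝓝 0) (𝓝 (‖x‖ ^ 2 - 0)) :=
    tendsto_const_nhds.sub tendsto_id
  simp_rw [swirlField_apply]
  exact ((h.inv₀ hx2).smul_const (rotJ x)).mono_left nhdsWithin_le_nhds

/-- The trace slice is measurable. -/
theorem measurable_swirlField_zero : Measurable (swirlField 0) :=
  ((measurable_norm.pow_const 2).sub_const 0).inv.smul rotJ.continuous.measurable

/-- The unit-scale energy majorant: `‖swirlField t y‖² ≤ 1_{B₁}(y)‖y‖⁻² + 1`. -/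
theorem ofReal_sq_norm_swirlField_le {t : ℝ} (ht : t ≤ 0) (y : EuclideanSpace ℝ (Fin 3)) :
    ENNReal.ofReal (‖swirlField t y‖ ^ 2) ≤
      (ball (0 : EuclideanSpace ℝ (Fin 3)) 1).indicator (fun y => ENNReal.ofReal (‖y‖ ^ (-2 : ℝ))) y + 1 := by
  by_cases hy : y = 0
  · subst hy
    simp [swirlField_apply]
  have hy1 : ‖swirlField t y‖ ^ 2 ≤ ‖y‖ ^ (-2 : ℝ) := by
    calc ‖swirlField t y‖ ^ 2 ≤ (1 / ‖y‖) ^ 2 :=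
        pow_le_pow_left₀ (norm_nonneg _) (norm_swirlField_le_inv ht hy) 2
      _ = ‖y‖ ^ (-2 : ℝ) := by rw [Real.rpow_neg (norm_nonneg _), Real.rpow_two, one_div, inv_pow]
  by_cases hyb : y ∈ ball (0 : EuclideanSpace ℝ (Fin 3)) 1
  · rw [indicator_of_mem hyb]
    exact le_add_right (ENNReal.ofReal_le_ofReal hy1)
  · rw [indicator_of_notMem hyb, zero_add]
    have hy2 : 1 ≤ ‖y‖ := by simpa [mem_ball_zero_iff] using hyb
    have hy3 : ‖y‖ ^ (-2 : ℝ) ≤ 1 := by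
      rw [Real.rpow_neg (norm_nonneg _), Real.rpow_two]
      exact inv_le_one_of_one_le₀ (one_le_pow₀ hy2)
    calc ENNReal.ofReal (‖swirlField t y‖ ^ 2) ≤ ENNReal.ofReal 1 := ENNReal.ofReal_le_ofReal (hy1.trans hy3)
      _ = 1 := ENNReal.ofReal_one

/-- **Uniform unit-scale energy**: `∫_{B(x₀,1)} ‖swirlField t‖² ≤ ∫_{B₁}‖y‖⁻² + |B₁|` for every
centre `x₀` and every `t ≤ 0`. -/
theorem lintegral_ball_sq_swirlField_le {t : ℝ} (ht : t ≤ 0) (x₀ : EuclideanSpace ℝ (Fin 3)) :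
    ∫⁻ y in ball x₀ 1, ENNReal.ofReal (‖swirlField t y‖ ^ 2) ≤
      (∫⁻ y in ball (0 : EuclideanSpace ℝ (Fin 3)) 1, ENNReal.ofReal (‖y‖ ^ (-2 : ℝ))) +
        volume (ball (0 : EuclideanSpace ℝ (Fin 3)) 1) := by
  calc ∫⁻ y in ball x₀ 1, ENNReal.ofReal (‖swirlField t y‖ ^ 2)
      ≤ ∫⁻ y in ball x₀ 1, ((ball (0 : EuclideanSpace ℝ (Fin 3)) 1).indicator
          (fun y => ENNReal.ofReal (‖y‖ ^ (-2 : ℝ))) y + 1) :=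
        lintegral_mono fun y => ofReal_sq_norm_swirlField_le ht y
    _ = (∫⁻ y in ball x₀ 1, (ball (0 : EuclideanSpace ℝ (Fin 3)) 1).indicator
          (fun y => ENNReal.ofReal (‖y‖ ^ (-2 : ℝ))) y) + volume (ball x₀ 1) := by
        rw [lintegral_add_right _ measurable_const, setLIntegral_one]
    _ ≤ (∫⁻ y, (ball (0 : EuclideanSpace ℝ (Fin 3)) 1).indicator
          (fun y => ENNReal.ofReal (‖y‖ ^ (-2 : ℝ))) y) + volume (ball x₀ 1) :=
        add_le_add (setLIntegral_le_lintegral _ _) le_rfl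
    _ = _ := by rw [lintegral_indicator measurableSet_ball, Measure.addHaar_ball_center]

/-- The singular ball integral is finite: `‖y‖⁻² ∈ L¹(B₁)` in dimension three. -/
theorem lintegral_ball_rpow_neg_two_lt_top :
    (∫⁻ y in ball (0 : EuclideanSpace ℝ (Fin 3)) 1, ENNReal.ofReal (‖y‖ ^ (-2 : ℝ))) < ⊤ :=
  (PDE.Newtonian.integrableOn_ball_norm_rpow_neg (E := EuclideanSpace ℝ (Fin 3))
    (by rw [finrank_euclideanSpace_fin]) (by rw [finrank_euclideanSpace_fin]; norm_num) 1).lintegral_lt_top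

/-- **The scaled swirl is backward self-similar**: `λ v(λ²t, λx) = v(t,x)` for `λ > 0`. -/
theorem isSelfSimilar_swirlScaled (κ : ℝ) : IsSelfSimilar (swirlScaled κ) := by
  intro c hc
  funext t x
  have hc2 : (c ^ 2 : ℝ) ≠ 0 := by positivity
  simp only [nsRescale, swirlScaled_apply, swirlField_apply, map_smul, norm_smul, mul_pow,
    Real.norm_eq_abs, sq_abs, smul_smul]
  congr 1
  rw [← mul_sub, mul_inv]
  field_simp

end Summit.NavierStokesRegularity.NavierStokesRegularity.Theorems.TypeIQuantSubcubicExp.Negative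

end
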